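/-
Copyright: the b2b-balaban cell (near-miss cell 7), T⁴-continuum CRUX team (coordinator ruling e34b3e0c item (2)),
seat t4-ne7b-formalise-leaf-05 (gen 67). Released under the licence of the surrounding project.
-/
import Mathlib.Analysis.SpecialFunctions.Pow.Real

/-!
# The growth lemma S4 of route-shape R-SI «screening isoperimetry»
# (estimate NE7b, `t4/ROUTES-NE7b.md` v12, block «WHAT CHANGED v11.3 → v12» item (3), step S4 [GROWTH])

Cell `pub-balaban`, sub-cell `t4`, spine estimate NE7b (node U5c). ROUTES-NE7b v12 (seat `t4-ne7b-idea-1` gen 12,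
2026-08-22) files the route-shape R-SI as the proof line of the re-open clause of candidate C-RH° (KILL PROPOSED for the
2026-08-28 review, author concurring). Its steps S1–S3 and S6 are geometry (flat approximation, screening competitor,
covering count, boundary version); its step S4 is a lemma about REAL SEQUENCES, named there as «the one piece of R-SI a
prover can kernel-check TODAY without any geometry»:

  S4 «`E_k > 0` nondecreasing, `E₀ ≥ ε₀`, and for every `k` either (`E_{k+1} − E_k ≤ ε₀` and `E_k ≤ C_a (E_{k+1} − E_k)`)
  or (`E_{k+1} − E_k ≥ ε₀` and `E_k ≤ C_b ((E_{k+1} − E_k)/ε₀)^{3/4}`). Then: while `E_k ≤ C_a ε₀`, `E_{k+1} ≥ (1 + 1/C_a) E_k`;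
  once `E_k > C_a ε₀` the first branch is impossible and `E_{k+1} ≥ E_k + ε₀ · max(1, (E_k/C_b)^{4/3})`; hence `log E_k`
  grows at least like `(4/3)^{k−k₁}` after an explicit `k₁`, and for every `Λ`, `E_*` there is a `k*` with `E_k > E_* Λ^k`
  for all `k ≥ k*` — the lower bound is eventually double-exponential in `k`, so it beats every geometric bound.»

(In R-SI it is applied with `E_k := e(4^k r₀)`, the Yang–Mills energy in the ball `B_{4^k r₀}(x₀)`; the dichotomy is the
master inequality (★a)/(★b) at `r = 2·4^k r₀`, whose annulus energy `a(r) = e(2r) − e(r/2)` is exactly `E_{k+1} − E_k`.)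

THIS FILE PROVES the dynamics of S4, for a sequence `E : ℕ → ℝ` and reals `ε₀, Ca, Cb > 0` packaged as
one standing hypothesis `h` — the conjunction `0 < ε₀ ∧ 0 < Ca ∧ 0 < Cb ∧ ε₀ ≤ E 0 ∧ ∀ k, (★a)_k ∨ (★b)_k` with the
dichotomy exactly as displayed (`hyp_of_imp` builds it from the implication form (★a) ∧ (★b)); positivity and monotonicity of `E` are NOT assumed — they follow, `eps_le` / `lt_succ_term`):
* `small_step` — while `E k ≤ Ca·ε₀`: `(1 + 1/Ca)·E k ≤ E (k+1)`; `small_phase_lower` — `ε₀ (1+1/Ca)^k ≤ E k` there;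
* `large_of_sq_le` — EXIT of the small phase at an explicit index: `Ca·ε₀ < E k` for every `k ≥ Ca²`;
* `large_branch` / `large_step` — once `Ca·ε₀ < E k` the first branch is impossible and
  `E k + ε₀ · max 1 ((E k/Cb)^{4/3}) ≤ E (k+1)`; `linear_lower` — thereafter `E (k₀+n) ≥ E k₀ + n ε₀`;
* `le_at_threshold` — every level `T` is passed at the explicit index `⌈Ca²⌉₊ + ⌈T/ε₀⌉₊`;
* `dexp_step` — the normalised `v k := E k · ε₀³/Cb⁴` satisfies `v (k+1) ≥ (v k)^{4/3}` in the large phase;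
  `dexp_lower` — `v (k₁+j) ≥ 2^{(4/3)^j}` once `v k₁ ≥ 2`; `dexp_lower_explicit` — the same from the explicit
  `k₁ := ⌈Ca²⌉₊ + ⌈2 Cb⁴/ε₀⁴⌉₊`, i.e. `E (k₁+j) ≥ (Cb⁴/ε₀³)·2^{(4/3)^j}`: `log E` grows at least like `(4/3)^j`,
  which is S4's «log E_k grows at least like (4/3)^{k−k₁}» with an explicit `k₁`.
The SEQUEL `…Spine.NE7b.ScreeningGrowthBeatsGeometric` derives S4's headline («beats every geometric bound `E_*·Λ^k`»,
with an explicit index) and the form corollary LV2⁺ consumes (`exp(a·θ^k) < E k` eventually for every `θ < 4/3`,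
in particular `θ = 4^{1/5}`: sub-`exp(R^{1/5})` growth along `R = 4^k r₀`).

CONSTANTS. The indices here are explicit but cruder than the words of v12 (which state `k₁ ≤ (C_a+1) ln C_a + 2C_b/ε₀ + 2`):
the small phase is exited by `k ≥ Ca²` (Bernoulli, instead of `(Ca+1) ln Ca + 2`) and the double-exponential threshold
`2Cb⁴/ε₀³` is reached using only the increment `ε₀` per step (`⌈2Cb⁴/ε₀⁴⌉₊` steps, instead of a count linear in `Cb/ε₀`
that the superlinear increment `ε₀ (E_k/C_b)^{4/3}` would give). R-SI's constant is «EFFECTIVE but astronomical» either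
way (v12: `C_MP ≥ 16^{40 000}`), and its NE7b value is conditional on LV5 regardless; the sharper counts are not claimed here.

HONEST FRAMING. Law-free real analysis about one real sequence; it says nothing about S1–S3, S6, (★), ε-regularity, or
any configuration of a gauge field, and nothing of [Bałaban 1983–89] is read, asserted or cited. R-SI is booked «rank 3
CANDIDATE, 0 seats, unfunded, price HIGH»; C-RH° stays KILL PROPOSED 2026-08-28 with the author's concurrence; this file
changes neither booking. NE7b (`T4WeightBudget.RelWeightBound`) NOT PRINTED and NOT PROVED; spine PROVED 0∕9; rung (B)+1
on a FINITE torus T⁴ — NOT infinite volume, NOT the mass gap, NOT Clay. HONEST DEPENDENCY: continuum YM on T⁴ ⇐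
BetaPertH ∧ nine spine estimates (0/9 proved); BetaPertH ⇐ (D1) ∧ (D4) ∧ CAP+tail; G-an2-4 gates asym, D1 and NE2/3/4.
POLICY: crux-route work under `Spine/NE7b/` (the K-typable item named in ROUTES v12 Δv12 (3) S4), not a
`T4Continuum/Support` leaf (FREEZE (0) respected); 0 `def` (the hypothesis is a plain conjunction),
no `Prop`-valued fact, no `[cite:]` fact; Mathlib-only imports.
-/

set_option autoImplicit false

namespace Summit.QuantumFields.BalabanUV.T4Continuum.NE7b.ScreeningGrowth

/-!
## The hypotheses of S4

Throughout, `E : ℕ → ℝ` is the sequence and `ε₀, Ca, Cb` the quantum and the two constants; the standing hypothesis `h`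
is the CONJUNCTION «`0 < ε₀ ∧ 0 < Ca ∧ 0 < Cb ∧ ε₀ ≤ E 0 ∧ ∀ k, (★a)_k ∨ (★b)_k`» with
(★a)_k «`E (k+1) − E k ≤ ε₀ ∧ E k ≤ Ca·(E (k+1) − E k)`» (hole-filling branch) and
(★b)_k «`ε₀ ≤ E (k+1) − E k ∧ E k ≤ Cb·((E (k+1) − E k)/ε₀)^{3/4}`» (isoperimetric branch) — the dichotomy exactly as
displayed in S4; `hyp_of_imp` builds it from the implication form in which (★) is stated. Positivity and monotonicity
of `E` are NOT part of `h`: they follow (§1). (A plain conjunction, no definition: nothing is named or asserted.)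
-/

section Hyp

variable {E : ℕ → ℝ} {ε₀ Ca Cb : ℝ}

/-- Constructor of the standing hypothesis from the implication form in which (★) is stated:
`(Δ_k ≤ ε₀ → E k ≤ Ca·Δ_k)` and `(ε₀ ≤ Δ_k → E k ≤ Cb·(Δ_k/ε₀)^{3/4})`, `Δ_k := E (k+1) − E k`. -/
theorem hyp_of_imp (hε : 0 < ε₀) (hCa : 0 < Ca) (hCb : 0 < Cb) (h0 : ε₀ ≤ E 0)
    (ha : ∀ k : ℕ, E (k + 1) - E k ≤ ε₀ → E k ≤ Ca * (E (k + 1) - E k))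
    (hb : ∀ k : ℕ, ε₀ ≤ E (k + 1) - E k → E k ≤ Cb * ((E (k + 1) - E k) / ε₀) ^ (3 / 4 : ℝ)) :
    0 < ε₀ ∧ 0 < Ca ∧ 0 < Cb ∧ ε₀ ≤ E 0 ∧ ∀ k : ℕ,
      (E (k + 1) - E k ≤ ε₀ ∧ E k ≤ Ca * (E (k + 1) - E k)) ∨
      (ε₀ ≤ E (k + 1) - E k ∧ E k ≤ Cb * ((E (k + 1) - E k) / ε₀) ^ (3 / 4 : ℝ)) := by
  refine ⟨hε, hCa, hCb, h0, fun k => ?_⟩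
  rcases le_total (E (k + 1) - E k) ε₀ with hk | hk
  · exact Or.inl ⟨hk, ha k hk⟩
  · exact Or.inr ⟨hk, hb k hk⟩

end Hyp

variable {E : ℕ → ℝ} {ε₀ Ca Cb : ℝ}
  (h : 0 < ε₀ ∧ 0 < Ca ∧ 0 < Cb ∧ ε₀ ≤ E 0 ∧ ∀ k : ℕ,
    (E (k + 1) - E k ≤ ε₀ ∧ E k ≤ Ca * (E (k + 1) - E k)) ∨
    (ε₀ ≤ E (k + 1) - E k ∧ E k ≤ Cb * ((E (k + 1) - E k) / ε₀) ^ (3 / 4 : ℝ)))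
include h

/-! ## §1 Positivity and monotonicity (consequences, not hypotheses) -/

/-- Every term is at least the quantum: `ε₀ ≤ E k`. -/
theorem eps_le (k : ℕ) : ε₀ ≤ E k := by
  induction k with
  | zero => exact h.2.2.2.1
  | succ k ih =>
    rcases h.2.2.2.2 k with ⟨-, hk⟩ | ⟨hk, -⟩
    · have hCa := h.2.1
      have hΔ : 0 < E (k + 1) - E k := by
        rcases lt_or_ge 0 (E (k + 1) - E k) with hpos | hneg
        · exact hpos
        · have : Ca * (E (k + 1) - E k) ≤ 0 := by nlinarith
          linarith [h.1]
      linarith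
    · linarith [h.1]

/-- Every term is positive. -/
theorem pos (k : ℕ) : 0 < E k := lt_of_lt_of_le h.1 (eps_le h k)

/-- The one-step increment is at least `min (E k / Ca) ε₀`. -/
theorem min_le_incr (k : ℕ) : min (E k / Ca) ε₀ ≤ E (k + 1) - E k := by
  rcases h.2.2.2.2 k with ⟨-, hk⟩ | ⟨hk, -⟩
  · have : E k / Ca ≤ E (k + 1) - E k := by
      rw [div_le_iff₀ h.2.1]; linarith
    exact le_trans (min_le_left _ _) this
  · exact le_trans (min_le_right _ _) hk

/-- Each step is a strict increase: `E k < E (k+1)`. -/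
theorem lt_succ_term (k : ℕ) : E k < E (k + 1) := by
  have h1 := min_le_incr h k
  have h2 : 0 < min (E k / Ca) ε₀ := lt_min (div_pos (pos h k) h.2.1) h.1
  linarith

/-- `E` is nondecreasing along `m ≤ n` (it is in fact strictly increasing, `lt_succ_term`). -/
theorem term_le_term {m n : ℕ} (hmn : m ≤ n) : E m ≤ E n :=
  (strictMono_nat_of_lt_succ (lt_succ_term h)).monotone hmn

/-! ## §2 The small phase `E k ≤ Ca·ε₀`: geometric growth, explicit exit -/

/-- SMALL PHASE: while `E k ≤ Ca·ε₀`, `E (k+1) ≥ (1 + 1/Ca)·E k` (either branch gives an increment `≥ E k / Ca`). -/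
theorem small_step (k : ℕ) (hk : E k ≤ Ca * ε₀) : (1 + 1 / Ca) * E k ≤ E (k + 1) := by
  have hCa := h.2.1
  have h1 := min_le_incr h k
  have h2 : E k / Ca ≤ ε₀ := by rw [div_le_iff₀ hCa]; linarith
  rw [min_eq_left h2] at h1
  have h3 : (1 + 1 / Ca) * E k = E k + E k / Ca := by ring
  linarith

/-- In the small phase the growth is geometric from `E 0 ≥ ε₀`: `ε₀·(1 + 1/Ca)^k ≤ E k`. -/
theorem small_phase_lower (k : ℕ) (hk : ∀ j < k, E j ≤ Ca * ε₀) : ε₀ * (1 + 1 / Ca) ^ k ≤ E k := by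
  induction k with
  | zero => simpa using h.2.2.2.1
  | succ k ih =>
    have h1 : ε₀ * (1 + 1 / Ca) ^ k ≤ E k := ih fun j hj => hk j (Nat.lt_succ_of_lt hj)
    have h2 := small_step h k (hk k (Nat.lt_succ_self k))
    have hq : 0 ≤ 1 + 1 / Ca := by have := h.2.1; positivity
    calc ε₀ * (1 + 1 / Ca) ^ (k + 1) = (1 + 1 / Ca) * (ε₀ * (1 + 1 / Ca) ^ k) := by ring
      _ ≤ (1 + 1 / Ca) * E k := mul_le_mul_of_nonneg_left h1 hq
      _ ≤ E (k + 1) := h2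

/-- EXIT of the small phase at an explicit index: `Ca·ε₀ < E k` for every `k ≥ Ca²`
(Bernoulli: `(1 + 1/Ca)^k ≥ 1 + k/Ca ≥ 1 + Ca > Ca`). -/
theorem large_of_sq_le (k : ℕ) (hk : Ca ^ 2 ≤ k) : Ca * ε₀ < E k := by
  rcases lt_or_ge (Ca * ε₀) (E k) with hlt | hle
  · exact hlt
  exfalso
  have hCa := h.2.1
  have hε := h.1
  have hsmall : ∀ j < k, E j ≤ Ca * ε₀ := fun j hj => le_trans (term_le_term h hj.le) hle
  have h1 := small_phase_lower h k hsmall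
  have hB : 1 + (k : ℝ) * (1 / Ca) ≤ (1 + 1 / Ca) ^ k :=
    one_add_mul_le_pow (by linarith [one_div_pos.mpr hCa]) k
  have h2 : Ca ≤ (k : ℝ) * (1 / Ca) := by
    rw [mul_one_div, le_div_iff₀ hCa]
    nlinarith [hk]
  have h3 : ε₀ * (1 + Ca) ≤ ε₀ * (1 + 1 / Ca) ^ k :=
    mul_le_mul_of_nonneg_left (by linarith) hε.le
  nlinarith

/-! ## §3 The large phase `Ca·ε₀ < E k`: only the isoperimetric branch survives -/

/-- LARGE PHASE: once `Ca·ε₀ < E k` the first branch is impossible, so (★b) holds. -/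
theorem large_branch (k : ℕ) (hk : Ca * ε₀ < E k) :
    ε₀ ≤ E (k + 1) - E k ∧ E k ≤ Cb * ((E (k + 1) - E k) / ε₀) ^ (3 / 4 : ℝ) := by
  rcases h.2.2.2.2 k with ⟨h1, h2⟩ | hb
  · exfalso
    have : Ca * (E (k + 1) - E k) ≤ Ca * ε₀ := mul_le_mul_of_nonneg_left h1 h.2.1.le
    linarith
  · exact hb

/-- LARGE PHASE growth law: `E (k+1) ≥ E k + ε₀ · max 1 ((E k / Cb)^{4/3})`. -/
theorem large_step (k : ℕ) (hk : Ca * ε₀ < E k) :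
    E k + ε₀ * max 1 ((E k / Cb) ^ (4 / 3 : ℝ)) ≤ E (k + 1) := by
  obtain ⟨h1, h2⟩ := large_branch h k hk
  have hε := h.1
  have hCb := h.2.2.1
  have hΔ0 : 0 ≤ (E (k + 1) - E k) / ε₀ := div_nonneg (by linarith) hε.le
  have h3 : E k / Cb ≤ ((E (k + 1) - E k) / ε₀) ^ (3 / 4 : ℝ) := by
    rw [div_le_iff₀ hCb]; linarith
  have h4 : (E k / Cb) ^ (4 / 3 : ℝ) ≤ (E (k + 1) - E k) / ε₀ := by
    have hEk : 0 ≤ E k / Cb := div_nonneg (pos h k).le hCb.le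
    calc (E k / Cb) ^ (4 / 3 : ℝ) ≤ (((E (k + 1) - E k) / ε₀) ^ (3 / 4 : ℝ)) ^ (4 / 3 : ℝ) :=
          Real.rpow_le_rpow hEk h3 (by norm_num)
      _ = (E (k + 1) - E k) / ε₀ := by
          rw [← Real.rpow_mul hΔ0]; norm_num
  have h5 : ε₀ * (E k / Cb) ^ (4 / 3 : ℝ) ≤ E (k + 1) - E k := by
    have := mul_le_mul_of_nonneg_left h4 hε.le
    have hc : ε₀ * ((E (k + 1) - E k) / ε₀) = E (k + 1) - E k := by field_simp
    linarith
  rcases le_total 1 ((E k / Cb) ^ (4 / 3 : ℝ)) with hm | hm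
  · rw [max_eq_right hm]; linarith
  · rw [max_eq_left hm]; linarith

/-- In the large phase every step adds at least the quantum: `E (k₀ + n) ≥ E k₀ + n·ε₀`. -/
theorem linear_lower (k₀ : ℕ) (hk : Ca * ε₀ < E k₀) (n : ℕ) : E k₀ + n * ε₀ ≤ E (k₀ + n) := by
  induction n with
  | zero => simp
  | succ n ih =>
    have hkn : Ca * ε₀ < E (k₀ + n) := lt_of_lt_of_le hk (term_le_term h (Nat.le_add_right k₀ n))
    have hs := large_step h (k₀ + n) hkn
    have hm : ε₀ * 1 ≤ ε₀ * max 1 ((E (k₀ + n) / Cb) ^ (4 / 3 : ℝ)) :=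
      mul_le_mul_of_nonneg_left (le_max_left _ _) h.1.le
    have he : k₀ + (n + 1) = k₀ + n + 1 := rfl
    rw [he]
    push_cast
    linarith

/-- THRESHOLD at an explicit index: every level `T` satisfies `T ≤ E (⌈Ca²⌉₊ + ⌈T/ε₀⌉₊)`. -/
theorem le_at_threshold (T : ℝ) : T ≤ E (⌈Ca ^ 2⌉₊ + ⌈T / ε₀⌉₊) := by
  have hk : Ca * ε₀ < E ⌈Ca ^ 2⌉₊ := large_of_sq_le h _ (Nat.le_ceil _)
  have h1 := linear_lower h _ hk ⌈T / ε₀⌉₊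
  have h2 : T ≤ (⌈T / ε₀⌉₊ : ℝ) * ε₀ := by
    have := Nat.le_ceil (T / ε₀)
    rwa [div_le_iff₀ h.1] at this
  have h3 : 0 < E ⌈Ca ^ 2⌉₊ := pos h _
  linarith

/-- The large phase holds at (and after) the threshold index. -/
theorem large_at_threshold (T : ℝ) : Ca * ε₀ < E (⌈Ca ^ 2⌉₊ + ⌈T / ε₀⌉₊) :=
  lt_of_lt_of_le (large_of_sq_le h _ (Nat.le_ceil _)) (term_le_term h (Nat.le_add_right _ _))

/-! ## §4 The double-exponential phase -/

/-- KEY STEP: with the normalisation `v k := E k · ε₀³ / Cb⁴`, the large-phase law gives `v (k+1) ≥ (v k)^{4/3}`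
(from `E (k+1) ≥ ε₀ (E k/Cb)^{4/3}` and `E k / Cb = v k · (Cb/ε₀)³`). -/
theorem dexp_step (k : ℕ) (hk : Ca * ε₀ < E k) :
    (E k * ε₀ ^ 3 / Cb ^ 4) ^ (4 / 3 : ℝ) ≤ E (k + 1) * ε₀ ^ 3 / Cb ^ 4 := by
  have hε := h.1
  have hCb := h.2.2.1
  have hEk := (pos h k).le
  have hs := large_step h k hk
  have h1 : ε₀ * (E k / Cb) ^ (4 / 3 : ℝ) ≤ E (k + 1) := by
    have := mul_le_mul_of_nonneg_left (le_max_right 1 ((E k / Cb) ^ (4 / 3 : ℝ))) hε.le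
    linarith
  have hy : 0 ≤ Cb / ε₀ := by positivity
  have hv : 0 ≤ E k * ε₀ ^ 3 / Cb ^ 4 := by positivity
  have hEq : E k / Cb = (E k * ε₀ ^ 3 / Cb ^ 4) * (Cb / ε₀) ^ 3 := by
    field_simp
  have hy3 : ((Cb / ε₀) ^ 3) ^ (4 / 3 : ℝ) = (Cb / ε₀) ^ 4 := by
    rw [← Real.rpow_natCast (Cb / ε₀) 3, ← Real.rpow_mul hy]
    norm_num
  rw [hEq, Real.mul_rpow hv (by positivity), hy3] at h1
  rw [le_div_iff₀ (by positivity)]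
  have hid : (E k * ε₀ ^ 3 / Cb ^ 4) ^ (4 / 3 : ℝ) * Cb ^ 4
      = (ε₀ * ((E k * ε₀ ^ 3 / Cb ^ 4) ^ (4 / 3 : ℝ) * (Cb / ε₀) ^ 4)) * ε₀ ^ 3 := by
    field_simp
  rw [hid]
  exact mul_le_mul_of_nonneg_right h1 (by positivity)

/-- DOUBLE-EXPONENTIAL PHASE: if the large phase holds at `k₁` and `v k₁ ≥ 2`, then `v (k₁ + j) ≥ 2^{(4/3)^j}`
for every `j` (so `log E (k₁+j)` grows at least like `(4/3)^j`). -/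
theorem dexp_lower (k₁ : ℕ) (hk : Ca * ε₀ < E k₁) (hv : 2 ≤ E k₁ * ε₀ ^ 3 / Cb ^ 4) (j : ℕ) :
    (2 : ℝ) ^ ((4 / 3 : ℝ) ^ j) ≤ E (k₁ + j) * ε₀ ^ 3 / Cb ^ 4 := by
  induction j with
  | zero => simpa using hv
  | succ j ih =>
    have hkj : Ca * ε₀ < E (k₁ + j) := lt_of_lt_of_le hk (term_le_term h (Nat.le_add_right _ _))
    have hs := dexp_step h (k₁ + j) hkj
    have h2 : (0 : ℝ) ≤ 2 ^ ((4 / 3 : ℝ) ^ j) := Real.rpow_nonneg (by norm_num) _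
    calc (2 : ℝ) ^ ((4 / 3 : ℝ) ^ (j + 1)) = ((2 : ℝ) ^ ((4 / 3 : ℝ) ^ j)) ^ (4 / 3 : ℝ) := by
          rw [pow_succ, Real.rpow_mul (by norm_num : (0 : ℝ) ≤ 2)]
      _ ≤ (E (k₁ + j) * ε₀ ^ 3 / Cb ^ 4) ^ (4 / 3 : ℝ) := Real.rpow_le_rpow h2 ih (by norm_num)
      _ ≤ E (k₁ + j + 1) * ε₀ ^ 3 / Cb ^ 4 := hs

/-- The double-exponential lower bound from the explicit index `k₁ := ⌈Ca²⌉₊ + ⌈2·Cb⁴/ε₀⁴⌉₊`: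
`(Cb⁴/ε₀³) · 2^{(4/3)^j} ≤ E (k₁ + j)` for every `j`. -/
theorem dexp_lower_explicit (j : ℕ) :
    Cb ^ 4 / ε₀ ^ 3 * (2 : ℝ) ^ ((4 / 3 : ℝ) ^ j) ≤ E (⌈Ca ^ 2⌉₊ + ⌈2 * Cb ^ 4 / ε₀ ^ 4⌉₊ + j) := by
  have hε := h.1
  have hCb := h.2.2.1
  have hT : 2 * Cb ^ 4 / ε₀ ^ 3 / ε₀ = 2 * Cb ^ 4 / ε₀ ^ 4 := by
    field_simp
  have hk : Ca * ε₀ < E (⌈Ca ^ 2⌉₊ + ⌈2 * Cb ^ 4 / ε₀ ^ 4⌉₊) := by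
    have h1 := large_at_threshold h (2 * Cb ^ 4 / ε₀ ^ 3)
    rw [hT] at h1
    exact h1
  have hle : 2 * Cb ^ 4 / ε₀ ^ 3 ≤ E (⌈Ca ^ 2⌉₊ + ⌈2 * Cb ^ 4 / ε₀ ^ 4⌉₊) := by
    have h1 := le_at_threshold h (2 * Cb ^ 4 / ε₀ ^ 3)
    rw [hT] at h1
    exact h1
  have hv : 2 ≤ E (⌈Ca ^ 2⌉₊ + ⌈2 * Cb ^ 4 / ε₀ ^ 4⌉₊) * ε₀ ^ 3 / Cb ^ 4 := by
    rw [le_div_iff₀ (by positivity)]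
    rw [div_le_iff₀ (by positivity)] at hle
    linarith
  have hd := dexp_lower h _ hk hv j
  rw [le_div_iff₀ (by positivity)] at hd
  rw [div_mul_eq_mul_div, div_le_iff₀ (by positivity)]
  linarith


end Summit.QuantumFields.BalabanUV.T4Continuum.NE7b.ScreeningGrowth
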